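import Literature.NumberTheory.Transcendental.PreBlochThreeSmooth
import HarnessLib

/-!
# Unique divisibility of `P(F)` (Dupont Thm. 8.16) split at Suslin's theorem: `{z}/p` respects
# the five-term relation (Suslin, ICM 1986, Thm. 6.3), as a named fact, and the assembly

NumberTheory/Transcendental. SPLIT RECORD (fact-decompose, 2026-08-16) of the named fact
`Literature.NumberTheory.Transcendental.Suslin1991_preBloch_isUniquelyDivisible`
(`PreBlochGroup.lean`; Dupont, *Scissors congruences, group homology and characteristic classes*
(2001), **Thm. 8.16**: "For `F` algebraically closed of characteristic zero `𝒫_F` is uniquely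
divisible", after Suslin). The tree proves, along the printed proof (Dupont pp. 42–43, Dupont–Sah
1982 §5): divisibility by every `n ≥ 1` (`PreBloch.nsmul_surjective`, Rogers' identity and the
distribution relation, `PreBlochRogersProofs.lean`), no `2`-torsion (`PreBloch.two_nsmul_injective`,
Dupont's (8.17), `PreBlochHalf.lean`), no `3`-torsion (`PreBloch.three_nsmul_injective`, by the
rationality of the Fermat cubic surface, `PreBlochThird.lean`), and the reduction
`PreBloch.isUniquelyDivisible_of_prime_injective_of_five_le`: **unique divisibility follows from
the injectivity of `p • (·)` for the primes `p ≥ 5`**. For those Dupont (p. 43) writes: "one must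
prove that … `{w}/n = ∑_{j<n} {ζʲ w^{1/n}}` is well-defined, i.e. respects the relation (8.13). …
In general this is rather complicated and uses more algebraic geometry. We refer to [Suslin, 1986]"
— Suslin, *Algebraic K-theory of fields*, Proc. ICM Berkeley 1986, §6, **Thm. 6.3** (the displayed
relation `Ψ(u, v, w) = 0` for `[x] ↦ ∑_{y^p = x} [y]`, proved by the rigidity Prop. 6.2 of
specializations of torsion elements of `B(F(C))` along a smooth curve, i.e. with the `K₃`-transfer;
full account in *`K₃` of a field and the Bloch group*, Proc. Steklov Inst. 183 (1991)). This file

* defines `PreBloch.rootSym n z = {z}/n := ∑_{rⁿ = z} ⟦r⟧` (over the multiset of `n`-th roots;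
  `thirdSym = rootSym 3`), with `rootSym_eq` and the distribution relation `n • {z}/n = ⟦z⟧`
  (`nsmul_rootSym`, Dupont Cor. 8.15 = the tree's `PreBloch.distribution'`);
* vendors Suslin's theorem as the named fact `Suslin1986_rootSym_five_term`: for `F`
  algebraically closed of characteristic `0` and every prime `p ≥ 5`, `{·}/p` respects Neumann's
  five-term relation (2.3) = Dupont's (8.13) (for `p = 3` this is the tree's THEOREM
  `PreBloch.thirdSym_five_term`; `p = 2` is Dupont's (8.17), also a theorem of the tree);
* PROVES the assembly `Suslin1991_preBloch_isUniquelyDivisible_holds_of`: the child makes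
  `{·}/p` a well-defined endomorphism `φ_p` of `P(F)` with `p • φ_p = id` (`nsmul_rootEndo`), hence
  `p • (·)` is injective (`a = φ_p(p a)`), and `isUniquelyDivisible_of_prime_injective_of_five_le`
  concludes — word for word the argument of `PreBlochThird.lean` for `p = 3`.

The child does not restate the parent (it is a statement about the root symbols on generators,
the printed intermediate; the parent is bijectivity of `n • (·)` for all `n`).

## References

* J. L. Dupont, *Scissors congruences, group homology and characteristic classes*, World
  Scientific 2001: (8.13), Thm. 8.14, Cor. 8.15, Thm. 8.16 and p. 43. [Dupont2001]
* A. A. Suslin, *Algebraic K-theory of fields*, Proc. ICM Berkeley 1986, vol. 1, 222–244: §6,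
  Prop. 6.2, Thm. 6.3. [Suslin1986]
* A. A. Suslin, *`K₃` of a field and the Bloch group*, Proc. Steklov Inst. Math. 183 (1991).
  [Suslin1991]
* W. D. Neumann, Geom. Topol. Monogr. 1 (1998), eq. (2.3). [Neumann1998]
-/

noncomputable section

namespace Literature.NumberTheory.Transcendental

namespace PreBloch

variable {F : Type*} [Field F]

open Polynomial

/-! ### The root symbols `{z}/n` -/

/-- **The symbol `{z}/n := ∑_{rⁿ = z} ⟦r⟧`** — the sum of the extended symbols (`PreBloch.sym`)
of the `n`-th roots of `z`, with multiplicity (Dupont p. 43: `{w}/n = ∑_{j<n} {ζʲ w^{1/n}}`;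
Suslin Thm. 6.3: `[x] ↦ ∑_{y^p = x} [y]`); `rootSym 3 = thirdSym`. [cite: Dupont2001, p. 43] -/
def rootSym (n : ℕ) (z : F) : PreBloch F :=
  ((Polynomial.nthRoots n z).map sym).sum

/-- `{z}/3` of `PreBlochThird.lean` is `rootSym 3`. [cite: Dupont2001, p. 43] -/
theorem thirdSym_eq_rootSym (z : F) : thirdSym z = rootSym 3 z := rfl

/-- `{z}/n = ∑_{j<n} ⟦ζʲ r⟧` for any `n`-th root `r` of `z` and any primitive `n`-th root of unity
`ζ`. [cite: Dupont2001, p. 43] -/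
theorem rootSym_eq {n : ℕ} {ζ : F} (hζ : IsPrimitiveRoot ζ n) {z r : F} (hr : r ^ n = z) :
    rootSym n z = ∑ j ∈ Finset.range n, sym (ζ ^ j * r) := by
  unfold rootSym
  rw [hζ.nthRoots_eq hr, Multiset.map_map, Finset.sum_eq_multiset_sum, Finset.range_val]
  rfl

/-- **The distribution relation `n • {z}/n = ⟦z⟧`** (Dupont Cor. 8.15, the tree's
`PreBloch.distribution'`). [cite: Dupont2001, Cor. 8.15] -/
theorem nsmul_rootSym [IsAlgClosed F] [CharZero F] {n : ℕ} (hn : 0 < n) (z : F) :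
    n • rootSym n z = sym z := by
  obtain ⟨ζ, hζ⟩ := exists_isPrimitiveRoot (F := F) (n := n) hn
  obtain ⟨r, hr⟩ := IsAlgClosed.exists_pow_nat_eq z hn
  rw [rootSym_eq hζ hr, ← distribution' hn hζ r, hr]

end PreBloch

/-! ### Suslin's theorem as a named fact -/

/-- **Suslin, ICM 1986, Thm. 6.3 (the input of Dupont's Thm. 8.16 for the primes `p ≥ 5`):
`{·}/p` respects the five-term relation.** For `F` algebraically closed of characteristic `0`,
a prime `p ≥ 5`, and `x ≠ y` in `F ∖ {0, 1}`:
`{x}/p − {y}/p + {y/x}/p − {(1 − x⁻¹)/(1 − y⁻¹)}/p + {(1 − x)/(1 − y)}/p = 0` in `P(F)`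
(`PreBloch.rootSym p`, Neumann's form (2.3) of the five-term relation = Dupont's (8.13) up to the
tree's change of generators; with `p`-th roots `uᵖ = x`, `vᵖ = y`, `wᵖ = (1−x)/(1−y)` this is
Suslin's displayed relation `Ψ(u, v, w) = ∑_ξ [ξu] − ∑_ξ [ξv] + ∑_ξ [ξ v/u] − ∑_ξ [ξ wv/u] + ∑_ξ [ξw] = 0`
on the surface `(1 − vᵖ) wᵖ = 1 − uᵖ`). Dupont p. 43: "one must prove that … `{w}/n` is
well-defined, i.e. respects the relation (8.13) … We refer to [Suslin, 1986]"; Suslin's proof: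
`Ψ` is `p`-torsion in `B(F)` and is the specialization of a universal element over the function
field of the curve `w = const` of that surface, so it vanishes by the rigidity Prop. 6.2 (transfer
on `B`, through `K₃^{ind}`). The cases `p = 2, 3` are THEOREMS of the tree (`PreBlochHalf`,
`PreBloch.thirdSym_five_term`: the Fermat cubic surface is rational); for `p ≥ 5` the surface is
of general type and only Suslin's argument is known. NOT proved in the tree.
[cite: Suslin1986, Thm. 6.3 (with Prop. 6.2)] [cite: Dupont2001, Thm. 8.16 and p. 43] -/
def Suslin1986_rootSym_five_term : Prop :=
  ∀ (F : Type) [Field F] [IsAlgClosed F] [CharZero F] (p : ℕ), p.Prime → 5 ≤ p →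
    ∀ x y : F, x ≠ 0 ∧ x ≠ 1 → y ≠ 0 ∧ y ≠ 1 → x ≠ y →
      PreBloch.rootSym p x - PreBloch.rootSym p y + PreBloch.rootSym p (y / x) -
          PreBloch.rootSym p ((1 - x⁻¹) / (1 - y⁻¹)) + PreBloch.rootSym p ((1 - x) / (1 - y)) = 0

namespace PreBloch

variable {F : Type} [Field F]

/-! ### The endomorphism `{·}/p` and the absence of `p`-torsion, granted Suslin's theorem -/

/-- `{·}/n` on the free abelian group of generators. [cite: Dupont2001, p. 43] -/
def rootLift (n : ℕ) : FreeAbelianGroup (Gen F) →+ PreBloch F :=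
  FreeAbelianGroup.lift fun g => rootSym n g.val

/-- Granted Suslin's theorem, `{·}/p` kills the five-term relators (`p ≥ 5` prime).
[cite: Suslin1986, Thm. 6.3] -/
theorem rootLift_relator [IsAlgClosed F] [CharZero F] (hS : Suslin1986_rootSym_five_term)
    {p : ℕ} (hp : p.Prime) (h5 : 5 ≤ p) {r : FreeAbelianGroup (Gen F)} (hr : r ∈ fiveTermRelators F) :
    rootLift p r = 0 := by
  obtain ⟨x, y, hxy, rfl⟩ := hr
  unfold fiveTermRelator rootLift
  simp only [map_add, map_sub, FreeAbelianGroup.lift_apply_of]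
  exact hS F p hp h5 x.val y.val ⟨x.val_ne_zero, x.val_ne_one⟩ ⟨y.val_ne_zero, y.val_ne_one⟩ hxy

/-- Granted Suslin's theorem, the relations lie in the kernel of `{·}/p`. [cite: Suslin1986, Thm. 6.3] -/
theorem closure_le_ker_rootLift [IsAlgClosed F] [CharZero F] (hS : Suslin1986_rootSym_five_term)
    {p : ℕ} (hp : p.Prime) (h5 : 5 ≤ p) :
    AddSubgroup.closure (fiveTermRelators F) ≤ (rootLift (F := F) p).ker :=
  (AddSubgroup.closure_le _).2 fun _ hr => rootLift_relator hS hp h5 hr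

/-- **The endomorphism `φ_p : P(F) → P(F)`, `[z] ↦ {z}/p`**, well defined granted Suslin's
theorem (`p ≥ 5` prime). [cite: Dupont2001, Thm. 8.16 and p. 43] -/
def rootEndo [IsAlgClosed F] [CharZero F] (hS : Suslin1986_rootSym_five_term)
    {p : ℕ} (hp : p.Prime) (h5 : 5 ≤ p) : PreBloch F →+ PreBloch F :=
  QuotientAddGroup.lift (AddSubgroup.closure (fiveTermRelators F)) (rootLift p)
    (closure_le_ker_rootLift hS hp h5)

/-- `φ_p [z] = {z}/p`. [cite: Dupont2001, Thm. 8.16] -/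
theorem rootEndo_mk [IsAlgClosed F] [CharZero F] (hS : Suslin1986_rootSym_five_term)
    {p : ℕ} (hp : p.Prime) (h5 : 5 ≤ p) (z : F) (hz : z ≠ 0 ∧ z ≠ 1) :
    rootEndo hS hp h5 (PreBloch.mk z hz) = rootSym p z := by
  show rootLift p (FreeAbelianGroup.of (⟨z, hz⟩ : Gen F)) = rootSym p z
  unfold rootLift
  rw [FreeAbelianGroup.lift_apply_of]
  rfl

/-- `p • φ_p = id` on `P(F)` (the distribution relation on generators).
[cite: Dupont2001, Cor. 8.15 and Thm. 8.16] -/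
theorem nsmul_rootEndo [IsAlgClosed F] [CharZero F] (hS : Suslin1986_rootSym_five_term)
    {p : ℕ} (hp : p.Prime) (h5 : 5 ≤ p) (a : PreBloch F) : p • rootEndo hS hp h5 a = a := by
  obtain ⟨w, rfl⟩ := PreBloch.proj_surjective a
  induction w using FreeAbelianGroup.induction_on with
  | zero => simp
  | of g =>
    rw [proj_of, rootEndo_mk, nsmul_rootSym hp.pos, sym_of_ne]
  | neg g ih => rw [map_neg, map_neg, smul_neg, ih]
  | add u v hu hv => rw [map_add, map_add, smul_add, hu, hv]

/-- **Granted Suslin's theorem, `P(F)` has no `p`-torsion for the primes `p ≥ 5`**: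
`p a = p b ⟹ a = φ_p(p a) = φ_p(p b) = b`. [cite: Dupont2001, Thm. 8.16] [cite: Suslin1986, Thm. 6.3] -/
theorem nsmul_injective_of_suslin [IsAlgClosed F] [CharZero F] (hS : Suslin1986_rootSym_five_term)
    {p : ℕ} (hp : p.Prime) (h5 : 5 ≤ p) :
    Function.Injective fun a : PreBloch F => p • a := by
  intro a b h
  simp only at h
  have ha := nsmul_rootEndo hS hp h5 a
  have hb := nsmul_rootEndo hS hp h5 b
  rw [← map_nsmul] at ha hb
  rw [← ha, ← hb, h]

end PreBloch

/-- **Assembly of the split: Dupont's Thm. 8.16 (`Suslin1991_preBloch_isUniquelyDivisible`) from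
Suslin's Thm. 6.3.** Divisibility (Cor. 8.15), `n = 2` ((8.17)) and `n = 3` are theorems of the
tree; the child supplies the injectivity of `p • (·)` for the primes `p ≥ 5`
(`PreBloch.nsmul_injective_of_suslin`), and `PreBloch.isUniquelyDivisible_of_prime_injective_of_five_le`
concludes. [cite: Dupont2001, Thm. 8.16] -/
theorem Suslin1991_preBloch_isUniquelyDivisible_holds_of (hS : Suslin1986_rootSym_five_term) :
    Suslin1991_preBloch_isUniquelyDivisible := fun _ _ _ _ =>
  PreBloch.isUniquelyDivisible_of_prime_injective_of_five_le fun _ hp h5 =>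
    PreBloch.nsmul_injective_of_suslin hS hp h5

/-- Sanity: the `p = 3` analogue of the child is a THEOREM of the tree (`thirdSym = rootSym 3`).
[cite: Dupont2001, Thm. 8.16] -/
theorem rootSym_three_five_term {F : Type*} [Field F] [IsAlgClosed F] [CharZero F] {x y : F}
    (hx : x ≠ 0 ∧ x ≠ 1) (hy : y ≠ 0 ∧ y ≠ 1) (hxy : x ≠ y) :
    PreBloch.rootSym 3 x - PreBloch.rootSym 3 y + PreBloch.rootSym 3 (y / x) -
        PreBloch.rootSym 3 ((1 - x⁻¹) / (1 - y⁻¹)) + PreBloch.rootSym 3 ((1 - x) / (1 - y)) = 0 :=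
  PreBloch.thirdSym_five_term hx hy hxy

end Literature.NumberTheory.Transcendental

end
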